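import Mathlib
import Literature.NumberTheory.Transcendental.AssociatorsFreeRepProofs
import HarnessLib

/-!
# Associators VII: the linearized pentagon implies the linearized hexagon
# [Furusho2010, Thm 3; BarnatanDancso2011, Main Lemma 3.2]

Sixth proofs file towards [Furusho2010, Thm 1] (`furusho_pentagon_hexagon`). It completes the
formalisation of the Lie-algebra version of "pentagon ⇒ hexagons", in Bar-Natan–Dancso's form:

> `Lemma 3.2. If φ ∈ U𝔉₂ is homogeneous of degree m ≥ 3 and is primitive, and satisfies the
> linearized pentagon equation dP(φ) = 0, then dH(φ) = 0.`

(`NCSeries.main_lemma`; [Furusho2010, Thm 3] is the same statement in `𝔓₅`.) We follow the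
printed proof [BarnatanDancso2011, §4] step by step:

1. the `S₄`-action on `U𝔞₄/(deg > N)` (`DrinfeldKohnoTrunc.permHom`) and the four permutations
   `σ₁ = id, σ₂ = 4231, σ₃ = 1342, σ₄ = 4312`;
2. `Σᵢ σᵢ(dP(ψ)) = dH(123) + dH((34)21) + dH(423) + dH((31)24)` after the cancellations by
   anti-symmetry (Lemma 4.1, `AssociatorsLieProofs.lean`), and the rewriting of the four `dH`'s as
   `R(X,Y) = ψ(X,Y) + ψ(Y,-X-Y) + ψ(-X-Y,X)` at chords through strand `2` by central shifts
   (`NCSeries.sum_R_eq_zero_of_dP`);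
3. transport to the free algebra on the chords through strand `2` by the retraction of
   `AssociatorsFreeRepProofs.lean`, then the two projections `p₁ : x₁,x₃,x₄ ↦ X,Y,X` and
   `p₂ : x₁,x₃,x₄ ↦ X,X,Y`, giving `R(X+Y,X) = -R(X,Y)` and `R(2X,Y) = 2R(X,Y)`;
4. the coefficient argument: `R(2X,Y) = 2R(X,Y)` kills all words without exactly one `X`,
   anti-symmetry `R(Y,X) = -R(X,Y)` and the absence of terms of degree `≤ 2` kill the rest, so
   `R(X,Y) = 0`, which is `dH(ψ) = 0` by [BarnatanDancso2011, Lemma 4.2].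

No named facts are introduced.

## References

* H. Furusho, *Pentagon and hexagon equations*, Ann. of Math. 171 (2010), 545–556, §1, Thm 3.
  [Furusho2010]
* D. Bar-Natan, Z. Dancso, *Pentagon and hexagon equations following Furusho*, Proc. AMS 140
  (2012), 1243–1250, §4 (Lemmas 4.1, 4.2 and the proof of the Main Lemma). [BarnatanDancso2011]
-/

noncomputable section

open scoped BigOperators

namespace Literature.NumberTheory.Transcendental

universe u v

/-! ## 1. The `S₄`-action on the truncated Drinfeld–Kohno algebra -/

namespace DrinfeldKohnoTrunc

variable {R : Type u} [CommRing R] {ι : Type v} {N : ℕ}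

/-- Relabelling the strands by a permutation is compatible with the relations. [folklore] -/
theorem perm_compatible (σ : Equiv.Perm ι) : Compatible N (fun i j => t R N (σ i) (σ j)) where
  diag _ := t_self _
  symm _ _ := t_symm _ _
  fourTerm _ _ _ hij hjl hil :=
    t_mul_add _ _ _ (σ.injective.ne hij) (σ.injective.ne hjl) (σ.injective.ne hil)
  locality _ _ _ _ h1 h2 h3 h4 h5 h6 :=
    t_comm _ _ _ _ (σ.injective.ne h1) (σ.injective.ne h2) (σ.injective.ne h3) (σ.injective.ne h4)
      (σ.injective.ne h5) (σ.injective.ne h6)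
  trunc g := prod_t_eq_zero fun r => (σ (g r).1, σ (g r).2)

/-- **The `S_ι`-action** on `U𝔞_ι ⊗ R/(deg > N)`: `t i j ↦ t (σ i) (σ j)`. [folklore] -/
def permHom (σ : Equiv.Perm ι) : DrinfeldKohnoTrunc R ι N →ₐ[R] DrinfeldKohnoTrunc R ι N :=
  (perm_compatible (R := R) (N := N) σ).lift

/-- `permHom σ (t i j) = t (σ i) (σ j)`. [folklore] -/
@[simp] theorem permHom_t (σ : Equiv.Perm ι) (i j : ι) :
    permHom (R := R) (N := N) σ (t R N i j) = t R N (σ i) (σ j) :=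
  (perm_compatible (R := R) (N := N) σ).lift_t i j

/-- The permutation `4231` of [BarnatanDancso2011, §4] on strands `0..3`: `0 ↔ 3`. [folklore] -/
def σ₂ : Equiv.Perm (Fin 4) := ⟨![3, 1, 2, 0], ![3, 1, 2, 0], by decide, by decide⟩

/-- The permutation `1342` of [BarnatanDancso2011, §4] on strands `0..3`: `1 ↦ 2 ↦ 3 ↦ 1`.
[folklore] -/
def σ₃ : Equiv.Perm (Fin 4) := ⟨![0, 2, 3, 1], ![0, 3, 1, 2], by decide, by decide⟩

/-- The permutation `4312` of [BarnatanDancso2011, §4] on strands `0..3`: `0 ↦ 3 ↦ 1 ↦ 2 ↦ 0`.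
[folklore] -/
def σ₄ : Equiv.Perm (Fin 4) := ⟨![3, 2, 0, 1], ![2, 3, 1, 0], by decide, by decide⟩

/-- Value of `σ₂` at `0`. [folklore] -/
@[simp] theorem σ₂_0 : σ₂ 0 = 3 := rfl
/-- Value of `σ₂` at `1`. [folklore] -/
@[simp] theorem σ₂_1 : σ₂ 1 = 1 := rfl
/-- Value of `σ₂` at `2`. [folklore] -/
@[simp] theorem σ₂_2 : σ₂ 2 = 2 := rfl
/-- Value of `σ₂` at `3`. [folklore] -/
@[simp] theorem σ₂_3 : σ₂ 3 = 0 := rfl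
/-- Value of `σ₃` at `0`. [folklore] -/
@[simp] theorem σ₃_0 : σ₃ 0 = 0 := rfl
/-- Value of `σ₃` at `1`. [folklore] -/
@[simp] theorem σ₃_1 : σ₃ 1 = 2 := rfl
/-- Value of `σ₃` at `2`. [folklore] -/
@[simp] theorem σ₃_2 : σ₃ 2 = 3 := rfl
/-- Value of `σ₃` at `3`. [folklore] -/
@[simp] theorem σ₃_3 : σ₃ 3 = 1 := rfl
/-- Value of `σ₄` at `0`. [folklore] -/
@[simp] theorem σ₄_0 : σ₄ 0 = 3 := rfl
/-- Value of `σ₄` at `1`. [folklore] -/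
@[simp] theorem σ₄_1 : σ₄ 1 = 2 := rfl
/-- Value of `σ₄` at `2`. [folklore] -/
@[simp] theorem σ₄_2 : σ₄ 2 = 0 := rfl
/-- Value of `σ₄` at `3`. [folklore] -/
@[simp] theorem σ₄_3 : σ₄ 3 = 1 := rfl

section Fin4

variable {k : Type u} [CommRing k] {N : ℕ}

/-- Normal forms `t i j`, `i < j`, on four strands. [folklore] -/
@[simp] theorem t_10 : t k N (1 : Fin 4) 0 = t k N 0 1 := t_symm _ _
/-- Normal form of `t 2 0` on four strands. [folklore] -/
@[simp] theorem t_20 : t k N (2 : Fin 4) 0 = t k N 0 2 := t_symm _ _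
/-- Normal form of `t 3 0` on four strands. [folklore] -/
@[simp] theorem t_30 : t k N (3 : Fin 4) 0 = t k N 0 3 := t_symm _ _
/-- Normal form of `t 2 1` on four strands. [folklore] -/
@[simp] theorem t_21 : t k N (2 : Fin 4) 1 = t k N 1 2 := t_symm _ _
/-- Normal form of `t 3 1` on four strands. [folklore] -/
@[simp] theorem t_31 : t k N (3 : Fin 4) 1 = t k N 1 3 := t_symm _ _
/-- Normal form of `t 3 2` on four strands. [folklore] -/
@[simp] theorem t_32 : t k N (3 : Fin 4) 2 = t k N 2 3 := t_symm _ _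

/-- The infinitesimal braid relation on four strands, as a `Commute` statement with normal-form
generators: `t_ij` commutes with `t_il + t_jl` for the triangle `{i, j, l}` (all `24` orderings
are instances; we record the ones used). [folklore] -/
theorem commute_t01_t02_add_t12 : Commute (t k N (0 : Fin 4) 1) (t k N 0 2 + t k N 1 2) :=
  t_mul_add _ _ _ (by decide) (by decide) (by decide)

/-- Infinitesimal braid relation instance `commute_t01_t03_add_t13`. [folklore] -/
theorem commute_t01_t03_add_t13 : Commute (t k N (0 : Fin 4) 1) (t k N 0 3 + t k N 1 3) :=
  t_mul_add _ _ _ (by decide) (by decide) (by decide)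

/-- Infinitesimal braid relation instance `commute_t12_t01_add_t02`. [folklore] -/
theorem commute_t12_t01_add_t02 : Commute (t k N (1 : Fin 4) 2) (t k N 0 1 + t k N 0 2) := by
  have h := t_mul_add (R := k) (N := N) (1 : Fin 4) 2 0 (by decide) (by decide) (by decide)
  rw [t_10, t_20] at h
  exact h

/-- Infinitesimal braid relation instance `commute_t12_t13_add_t23`. [folklore] -/
theorem commute_t12_t13_add_t23 : Commute (t k N (1 : Fin 4) 2) (t k N 1 3 + t k N 2 3) :=
  t_mul_add _ _ _ (by decide) (by decide) (by decide)

/-- Infinitesimal braid relation instance `commute_t13_t01_add_t03`. [folklore] -/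
theorem commute_t13_t01_add_t03 : Commute (t k N (1 : Fin 4) 3) (t k N 0 1 + t k N 0 3) := by
  have h := t_mul_add (R := k) (N := N) (1 : Fin 4) 3 0 (by decide) (by decide) (by decide)
  rw [t_10, t_30] at h
  exact h

/-- Infinitesimal braid relation instance `commute_t13_t12_add_t23`. [folklore] -/
theorem commute_t13_t12_add_t23 : Commute (t k N (1 : Fin 4) 3) (t k N 1 2 + t k N 2 3) := by
  have h := t_mul_add (R := k) (N := N) (1 : Fin 4) 3 2 (by decide) (by decide) (by decide)
  rw [t_32] at h
  exact h

/-- Infinitesimal braid relation instance `commute_t02_t01_add_t12`. [folklore] -/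
theorem commute_t02_t01_add_t12 : Commute (t k N (0 : Fin 4) 2) (t k N 0 1 + t k N 1 2) := by
  have h := t_mul_add (R := k) (N := N) (0 : Fin 4) 2 1 (by decide) (by decide) (by decide)
  rw [t_21] at h
  exact h

/-- Infinitesimal braid relation instance `commute_t23_t12_add_t13`. [folklore] -/
theorem commute_t23_t12_add_t13 : Commute (t k N (2 : Fin 4) 3) (t k N 1 2 + t k N 1 3) := by
  have h := t_mul_add (R := k) (N := N) (2 : Fin 4) 3 1 (by decide) (by decide) (by decide)
  rw [t_21, t_31] at h
  exact h

/-- Locality instances. [folklore] -/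
theorem commute_t01_t23 : Commute (t k N (0 : Fin 4) 1) (t k N 2 3) :=
  t_comm _ _ _ _ (by decide) (by decide) (by decide) (by decide) (by decide) (by decide)

/-- Locality instance `commute_t02_t13`. [folklore] -/
theorem commute_t02_t13 : Commute (t k N (0 : Fin 4) 2) (t k N 1 3) :=
  t_comm _ _ _ _ (by decide) (by decide) (by decide) (by decide) (by decide) (by decide)

/-- Locality instance `commute_t03_t12`. [folklore] -/
theorem commute_t03_t12 : Commute (t k N (0 : Fin 4) 3) (t k N 1 2) :=
  t_comm _ _ _ _ (by decide) (by decide) (by decide) (by decide) (by decide) (by decide)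

variable (k N) in
/-- The central element `Ω = Σ_{i<j} t_ij` of `U𝔞₄`. [folklore] -/
def Omega : DrinfeldKohnoTrunc k (Fin 4) N :=
  t k N 0 1 + t k N 0 2 + t k N 0 3 + t k N 1 2 + t k N 1 3 + t k N 2 3

/-- `Ω` commutes with `t₀₁`. [folklore] -/
theorem commute_t01_Omega : Commute (t k N (0 : Fin 4) 1) (Omega k N) := by
  have h : Omega k N = t k N 0 1 + (t k N 0 2 + t k N 1 2) + (t k N 0 3 + t k N 1 3) + t k N 2 3 := by
    rw [Omega]; abel
  rw [h]
  exact (((Commute.refl _).add_right commute_t01_t02_add_t12).add_right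
    commute_t01_t03_add_t13).add_right commute_t01_t23

/-- `Ω` commutes with `t₁₂`. [folklore] -/
theorem commute_t12_Omega : Commute (t k N (1 : Fin 4) 2) (Omega k N) := by
  have h : Omega k N = (t k N 0 1 + t k N 0 2) + t k N 0 3 + t k N 1 2 + (t k N 1 3 + t k N 2 3) := by
    rw [Omega]; abel
  rw [h]
  exact (((commute_t12_t01_add_t02.add_right commute_t03_t12.symm).add_right
    (Commute.refl _)).add_right commute_t12_t13_add_t23)

/-- `Ω` commutes with `t₁₃`. [folklore] -/
theorem commute_t13_Omega : Commute (t k N (1 : Fin 4) 3) (Omega k N) := by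
  have h : Omega k N = (t k N 0 1 + t k N 0 3) + t k N 0 2 + (t k N 1 2 + t k N 2 3) + t k N 1 3 := by
    rw [Omega]; abel
  rw [h]
  exact (((commute_t13_t01_add_t03.add_right commute_t02_t13.symm).add_right
    commute_t13_t12_add_t23).add_right (Commute.refl _))

end Fin4

end DrinfeldKohnoTrunc

namespace NCSeries

/-! ## 2. From `dP(ψ) = 0` to `Σ R = 0` on the chords through strand `1` -/

section SumR

variable {k : Type u} [CommRing k] {N : ℕ} {ψ : NCSeries Bool k}

local notation "𝔱" => (DrinfeldKohnoTrunc.t k N : Fin 4 → Fin 4 → DrinfeldKohnoTrunc k (Fin 4) N)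
local notation "ℰ[" a ", " b "]" => evalTrunc N (bsub a b) ψ

/-- Anti-symmetry evaluated: `ψ(b, a) = -ψ(a, b)` for any substitution, when
`ψ(X,Y) + ψ(Y,X) = 0`. [cite: BarnatanDancso2011, Lemma 4.1] -/
theorem eval_antisymm {A : Type*} [Ring A] [Algebra k A] (hanti : ψ + swapXY ψ = 0) (N : ℕ)
    (a b : A) : evalTrunc N (bsub b a) ψ = -evalTrunc N (bsub a b) ψ := by
  have h := congrArg (evalTrunc N (bsub a b)) hanti
  rw [evalTrunc_add, evalTrunc_swapXY] at h
  have h0 : evalTrunc N (bsub a b) (0 : NCSeries Bool k) = 0 := by simpa using evalTrunc_C N (bsub a b) (0 : k)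
  rw [h0] at h
  exact eq_neg_of_add_eq_zero_right h

/-- **`Σᵢ σᵢ(dP(ψ))`, regrouped** [BarnatanDancso2011, §4]: if `ψ` is anti-symmetric and
`dP_N(ψ) = 0`, the twelve surviving terms of `Σ_{i=1}^4 σᵢ(dP(ψ))` vanish:
`dH(123) + dH((34)21) + dH(423) + dH((31)24) = 0` (strands `1..4 ↦ 0..3`, each `dH(ABC)` written
as its three terms `ψ(t_AB,t_BC) + ψ(t_BC,t_CA) + ψ(t_CA,t_AB)`). [cite: BarnatanDancso2011, §4] -/
theorem sum_dH_eq_zero_of_dP (hanti : ψ + swapXY ψ = 0) (hP : dP k N ψ = 0) :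
    (ℰ[𝔱 0 1, 𝔱 1 2] + ℰ[𝔱 1 2, 𝔱 0 2] + ℰ[𝔱 0 2, 𝔱 0 1]) +
      (ℰ[𝔱 1 2 + 𝔱 1 3, 𝔱 0 1] + ℰ[𝔱 0 1, 𝔱 0 3 + 𝔱 0 2] + ℰ[𝔱 0 2 + 𝔱 0 3, 𝔱 1 2 + 𝔱 1 3]) +
      (ℰ[𝔱 1 3, 𝔱 1 2] + ℰ[𝔱 1 2, 𝔱 2 3] + ℰ[𝔱 2 3, 𝔱 1 3]) +
      (ℰ[𝔱 1 2 + 𝔱 0 1, 𝔱 1 3] + ℰ[𝔱 1 3, 𝔱 0 3 + 𝔱 2 3] + ℰ[𝔱 2 3 + 𝔱 0 3, 𝔱 1 2 + 𝔱 0 1]) = 0 := by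
  have hZ : ∀ σ : Equiv.Perm (Fin 4), DrinfeldKohnoTrunc.permHom σ (dP k N ψ) = 0 := fun σ => by
    rw [hP, map_zero]
  have h1 : -ℰ[𝔱 0 1, 𝔱 1 2 + 𝔱 1 3] - ℰ[𝔱 0 2 + 𝔱 1 2, 𝔱 2 3] + ℰ[𝔱 1 2, 𝔱 2 3] +
      ℰ[𝔱 0 1 + 𝔱 0 2, 𝔱 1 3 + 𝔱 2 3] + ℰ[𝔱 0 1, 𝔱 1 2] = 0 := hP
  have h2 : -ℰ[𝔱 1 3, 𝔱 1 2 + 𝔱 0 1] - ℰ[𝔱 2 3 + 𝔱 1 2, 𝔱 0 2] + ℰ[𝔱 1 2, 𝔱 0 2] +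
      ℰ[𝔱 1 3 + 𝔱 2 3, 𝔱 0 1 + 𝔱 0 2] + ℰ[𝔱 1 3, 𝔱 1 2] = 0 := by
    simpa [dP, map_add, map_sub, map_neg, subst₂, t₄, algHom_evalTrunc, comp_bsub] using
      hZ DrinfeldKohnoTrunc.σ₂
  have h3 : -ℰ[𝔱 0 2, 𝔱 2 3 + 𝔱 1 2] - ℰ[𝔱 0 3 + 𝔱 2 3, 𝔱 1 3] + ℰ[𝔱 2 3, 𝔱 1 3] +
      ℰ[𝔱 0 2 + 𝔱 0 3, 𝔱 1 2 + 𝔱 1 3] + ℰ[𝔱 0 2, 𝔱 2 3] = 0 := by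
    simpa [dP, map_add, map_sub, map_neg, subst₂, t₄, algHom_evalTrunc, comp_bsub] using
      hZ DrinfeldKohnoTrunc.σ₃
  have h4 : -ℰ[𝔱 2 3, 𝔱 0 2 + 𝔱 1 2] - ℰ[𝔱 0 3 + 𝔱 0 2, 𝔱 0 1] + ℰ[𝔱 0 2, 𝔱 0 1] +
      ℰ[𝔱 2 3 + 𝔱 0 3, 𝔱 1 2 + 𝔱 0 1] + ℰ[𝔱 2 3, 𝔱 0 2] = 0 := by
    simpa [dP, map_add, map_sub, map_neg, subst₂, t₄, algHom_evalTrunc, comp_bsub] using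
      hZ DrinfeldKohnoTrunc.σ₄
  -- the eight anti-symmetry rewrites (four cancelling pairs, four sign flips)
  rw [eval_antisymm hanti N (𝔱 1 2 + 𝔱 1 3) (𝔱 0 1)] at h1
  rw [eval_antisymm hanti N (𝔱 1 2 + 𝔱 0 1) (𝔱 1 3),
    eval_antisymm hanti N (𝔱 0 1 + 𝔱 0 2) (𝔱 1 3 + 𝔱 2 3)] at h2
  rw [eval_antisymm hanti N (𝔱 2 3 + 𝔱 1 2) (𝔱 0 2),
    eval_antisymm hanti N (𝔱 1 3) (𝔱 0 3 + 𝔱 2 3)] at h3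
  rw [eval_antisymm hanti N (𝔱 0 2 + 𝔱 1 2) (𝔱 2 3),
    eval_antisymm hanti N (𝔱 0 1) (𝔱 0 3 + 𝔱 0 2), eval_antisymm hanti N (𝔱 0 2) (𝔱 2 3)] at h4
  have hsum := congrArg₂ (· + ·) (congrArg₂ (· + ·) (congrArg₂ (· + ·) h1 h2) h3) h4
  simp only [add_zero] at hsum
  rw [← hsum]
  abel

/-- **The four `dH`'s as `R`'s at chords through strand `1`** [BarnatanDancso2011, §4, "every
chord appearing on the right side ends on strand 2"; Furusho2010, §1, `Σσᵢ(P) = ΣR`]: for a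
primitive anti-symmetric `ψ` without linear terms and with `dP_N(ψ) = 0`,
`R(t₀₁, t₁₂) + R(t₁₂ + t₁₃, t₀₁) + R(t₁₃, t₁₂) + R(t₁₂ + t₀₁, t₁₃) = 0`, where
`R(X,Y) = ψ(X,Y) + ψ(Y,-X-Y) + ψ(-X-Y,X)` — obtained from `sum_dH_eq_zero_of_dP` by the central
shifts `t₀₂ = -t₀₁-t₁₂ + (t₀₁+t₀₂+t₁₂)`, `t₂₃ = -t₁₂-t₁₃ + (t₁₂+t₁₃+t₂₃)`,
`t₀₂ + t₀₃ = -(t₁₂+t₁₃) - t₀₁ + (Ω - t₂₃)`, `t₀₃ + t₂₃ = -(t₁₂+t₀₁) - t₁₃ + (Ω - t₀₂)`.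
[cite: Furusho2010, §1] -/
theorem sum_R_eq_zero_of_dP [Algebra ℚ k] (hp : IsPrimitive ψ) (h0 : ψ [false] = 0) (h1 : ψ [true] = 0)
    (hanti : ψ + swapXY ψ = 0) (hP : dP k N ψ = 0) :
    (ℰ[𝔱 0 1, 𝔱 1 2] + ℰ[𝔱 1 2, -𝔱 0 1 - 𝔱 1 2] + ℰ[-𝔱 0 1 - 𝔱 1 2, 𝔱 0 1]) +
      (ℰ[𝔱 1 2 + 𝔱 1 3, 𝔱 0 1] + ℰ[𝔱 0 1, -(𝔱 1 2 + 𝔱 1 3) - 𝔱 0 1] +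
        ℰ[-(𝔱 1 2 + 𝔱 1 3) - 𝔱 0 1, 𝔱 1 2 + 𝔱 1 3]) +
      (ℰ[𝔱 1 3, 𝔱 1 2] + ℰ[𝔱 1 2, -𝔱 1 3 - 𝔱 1 2] + ℰ[-𝔱 1 3 - 𝔱 1 2, 𝔱 1 3]) +
      (ℰ[𝔱 1 2 + 𝔱 0 1, 𝔱 1 3] + ℰ[𝔱 1 3, -(𝔱 1 2 + 𝔱 0 1) - 𝔱 1 3] +
        ℰ[-(𝔱 1 2 + 𝔱 0 1) - 𝔱 1 3, 𝔱 1 2 + 𝔱 0 1]) = 0 := by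
  have hS := sum_dH_eq_zero_of_dP hanti hP
  -- group A: c = t01 + t02 + t12
  have cA1 : Commute (𝔱 0 1 + 𝔱 0 2 + 𝔱 1 2) (𝔱 0 1) := by
    rw [add_assoc]
    exact ((Commute.refl _).add_left DrinfeldKohnoTrunc.commute_t01_t02_add_t12.symm)
  have cA2 : Commute (𝔱 0 1 + 𝔱 0 2 + 𝔱 1 2) (𝔱 1 2) :=
    (DrinfeldKohnoTrunc.commute_t12_t01_add_t02.symm).add_left (Commute.refl _)
  have cAz : Commute (𝔱 0 1 + 𝔱 0 2 + 𝔱 1 2) (-𝔱 0 1 - 𝔱 1 2) := (cA1.neg_right).sub_right cA2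
  have eA : 𝔱 0 2 = (-𝔱 0 1 - 𝔱 1 2) + (𝔱 0 1 + 𝔱 0 2 + 𝔱 1 2) := by abel
  have sA1 : ℰ[𝔱 1 2, 𝔱 0 2] = ℰ[𝔱 1 2, -𝔱 0 1 - 𝔱 1 2] := by
    rw [eA]; exact hp.evalTrunc_bsub_add_right h1 N cA2 cAz
  have sA2 : ℰ[𝔱 0 2, 𝔱 0 1] = ℰ[-𝔱 0 1 - 𝔱 1 2, 𝔱 0 1] := by
    rw [eA]; exact hp.evalTrunc_bsub_add_left h0 N cAz cA1
  -- group C: c = t12 + t13 + t23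
  have cC1 : Commute (𝔱 1 2 + 𝔱 1 3 + 𝔱 2 3) (𝔱 1 3) := by
    have h : 𝔱 1 2 + 𝔱 1 3 + 𝔱 2 3 = 𝔱 1 3 + (𝔱 1 2 + 𝔱 2 3) := by abel
    rw [h]
    exact ((Commute.refl _).add_left DrinfeldKohnoTrunc.commute_t13_t12_add_t23.symm)
  have cC2 : Commute (𝔱 1 2 + 𝔱 1 3 + 𝔱 2 3) (𝔱 1 2) := by
    rw [add_assoc]
    exact ((Commute.refl _).add_left DrinfeldKohnoTrunc.commute_t12_t13_add_t23.symm)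
  have cCz : Commute (𝔱 1 2 + 𝔱 1 3 + 𝔱 2 3) (-𝔱 1 3 - 𝔱 1 2) := (cC1.neg_right).sub_right cC2
  have eC : 𝔱 2 3 = (-𝔱 1 3 - 𝔱 1 2) + (𝔱 1 2 + 𝔱 1 3 + 𝔱 2 3) := by abel
  have sC1 : ℰ[𝔱 1 2, 𝔱 2 3] = ℰ[𝔱 1 2, -𝔱 1 3 - 𝔱 1 2] := by
    rw [eC]; exact hp.evalTrunc_bsub_add_right h1 N cC2 cCz
  have sC2 : ℰ[𝔱 2 3, 𝔱 1 3] = ℰ[-𝔱 1 3 - 𝔱 1 2, 𝔱 1 3] := by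
    rw [eC]; exact hp.evalTrunc_bsub_add_left h0 N cCz cC1
  -- group B: c = Ω - t23
  have cB1 : Commute (DrinfeldKohnoTrunc.Omega k N - 𝔱 2 3) (𝔱 0 1) :=
    (DrinfeldKohnoTrunc.commute_t01_Omega.symm).sub_left DrinfeldKohnoTrunc.commute_t01_t23.symm
  have cB2 : Commute (DrinfeldKohnoTrunc.Omega k N - 𝔱 2 3) (𝔱 1 2 + 𝔱 1 3) :=
    ((DrinfeldKohnoTrunc.commute_t12_Omega.add_left DrinfeldKohnoTrunc.commute_t13_Omega).symm).sub_left
      DrinfeldKohnoTrunc.commute_t23_t12_add_t13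
  have cBz : Commute (DrinfeldKohnoTrunc.Omega k N - 𝔱 2 3) (-(𝔱 1 2 + 𝔱 1 3) - 𝔱 0 1) :=
    (cB2.neg_right).sub_right cB1
  have eB : 𝔱 0 3 + 𝔱 0 2 = (-(𝔱 1 2 + 𝔱 1 3) - 𝔱 0 1) + (DrinfeldKohnoTrunc.Omega k N - 𝔱 2 3) := by
    rw [DrinfeldKohnoTrunc.Omega]; abel
  have eB' : 𝔱 0 2 + 𝔱 0 3 = (-(𝔱 1 2 + 𝔱 1 3) - 𝔱 0 1) + (DrinfeldKohnoTrunc.Omega k N - 𝔱 2 3) := by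
    rw [DrinfeldKohnoTrunc.Omega]; abel
  have sB1 : ℰ[𝔱 0 1, 𝔱 0 3 + 𝔱 0 2] = ℰ[𝔱 0 1, -(𝔱 1 2 + 𝔱 1 3) - 𝔱 0 1] := by
    rw [eB]; exact hp.evalTrunc_bsub_add_right h1 N cB1 cBz
  have sB2 : ℰ[𝔱 0 2 + 𝔱 0 3, 𝔱 1 2 + 𝔱 1 3] = ℰ[-(𝔱 1 2 + 𝔱 1 3) - 𝔱 0 1, 𝔱 1 2 + 𝔱 1 3] := by
    rw [eB']; exact hp.evalTrunc_bsub_add_left h0 N cBz cB2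
  -- group D: c = Ω - t02
  have cD1 : Commute (DrinfeldKohnoTrunc.Omega k N - 𝔱 0 2) (𝔱 1 3) :=
    (DrinfeldKohnoTrunc.commute_t13_Omega.symm).sub_left DrinfeldKohnoTrunc.commute_t02_t13
  have cD2 : Commute (DrinfeldKohnoTrunc.Omega k N - 𝔱 0 2) (𝔱 1 2 + 𝔱 0 1) := by
    have h : Commute (DrinfeldKohnoTrunc.Omega k N - 𝔱 0 2) (𝔱 0 1 + 𝔱 1 2) :=
      ((DrinfeldKohnoTrunc.commute_t01_Omega.add_left DrinfeldKohnoTrunc.commute_t12_Omega).symm).sub_left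
        DrinfeldKohnoTrunc.commute_t02_t01_add_t12
    rwa [add_comm] at h
  have cDz : Commute (DrinfeldKohnoTrunc.Omega k N - 𝔱 0 2) (-(𝔱 1 2 + 𝔱 0 1) - 𝔱 1 3) :=
    (cD2.neg_right).sub_right cD1
  have eD : 𝔱 0 3 + 𝔱 2 3 = (-(𝔱 1 2 + 𝔱 0 1) - 𝔱 1 3) + (DrinfeldKohnoTrunc.Omega k N - 𝔱 0 2) := by
    rw [DrinfeldKohnoTrunc.Omega]; abel
  have eD' : 𝔱 2 3 + 𝔱 0 3 = (-(𝔱 1 2 + 𝔱 0 1) - 𝔱 1 3) + (DrinfeldKohnoTrunc.Omega k N - 𝔱 0 2) := by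
    rw [DrinfeldKohnoTrunc.Omega]; abel
  have sD1 : ℰ[𝔱 1 3, 𝔱 0 3 + 𝔱 2 3] = ℰ[𝔱 1 3, -(𝔱 1 2 + 𝔱 0 1) - 𝔱 1 3] := by
    rw [eD]; exact hp.evalTrunc_bsub_add_right h1 N cD1 cDz
  have sD2 : ℰ[𝔱 2 3 + 𝔱 0 3, 𝔱 1 2 + 𝔱 0 1] = ℰ[-(𝔱 1 2 + 𝔱 0 1) - 𝔱 1 3, 𝔱 1 2 + 𝔱 0 1] := by
    rw [eD']; exact hp.evalTrunc_bsub_add_left h0 N cDz cD2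
  rw [sA1, sA2, sC1, sC2, sB1, sB2, sD1, sD2] at hS
  exact hS

/-! ## 3. Transport to the free algebra on three letters and the two projections -/

/-- Coefficient vectors of the chord arguments: `lin N v` with `v` one of these is
`t₀₁, t₁₂, t₁₃, t₁₂+t₁₃, t₁₂+t₀₁` or their negatives. [folklore] -/
theorem lin_vec (a b c : k) :
    lin (k := k) N ![a, b, c] = a • 𝔱 0 1 + b • 𝔱 1 2 + c • 𝔱 1 3 := by
  simp only [lin, Fin.sum_univ_three, ell, t₄, letterStrand, Matrix.cons_val_zero,
    Matrix.cons_val_one, Matrix.cons_val_two, Matrix.head_cons, Matrix.tail_cons,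
    DrinfeldKohnoTrunc.t_10]

/-- Coefficient vectors of the letter arguments. [folklore] -/
theorem linV_vec (a b c : k) :
    linV (k := k) N ![a, b, c] = a • xg N 0 + b • xg N 1 + c • xg N 2 := by
  simp only [linV, Fin.sum_univ_three, Matrix.cons_val_zero, Matrix.cons_val_one,
    Matrix.cons_val_two, Matrix.head_cons, Matrix.tail_cons]

/-- `ψ(a, b)` at such arguments is transported by the retraction. [folklore] -/
theorem rep_eval_vec_one (a₁ b₁ c₁ a₂ b₂ c₂ : k) :
    rep k N (ℰ[a₁ • 𝔱 0 1 + b₁ • 𝔱 1 2 + c₁ • 𝔱 1 3, a₂ • 𝔱 0 1 + b₂ • 𝔱 1 2 + c₂ • 𝔱 1 3]) 1 =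
      evalTrunc N (bsub (a₁ • xg N 0 + b₁ • xg N 1 + c₁ • xg N 2)
        (a₂ • xg N 0 + b₂ • xg N 1 + c₂ • xg N 2)) ψ := by
  rw [← lin_vec, ← lin_vec, rep_evalTrunc_one, linV_vec, linV_vec]

end SumR

section Projections

variable {k : Type u} [CommRing k] {N : ℕ} {ψ : NCSeries Bool k}

local notation "𝒳" => (Ideal.Quotient.mk (truncIdeal Bool k N) X₀)
local notation "𝒴" => (Ideal.Quotient.mk (truncIdeal Bool k N) X₁)
local notation "ℰT[" a ", " b "]" => evalTrunc N (bsub a b) ψ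

/-- A substitution with values `[L c]`, `L c` without constant term, is `(N+1)`-nilpotent in
`k⟨⟨X,Y⟩⟩/(deg > N)`. [folklore] -/
theorem prod_map_mk_eq_zero {β : Type*} (L : β → NCSeries Bool k) (hL : ∀ b, L b [] = 0)
    (w : List β) (hw : N < w.length) :
    (w.map fun b => Ideal.Quotient.mk (truncIdeal Bool k N) (L b)).prod = 0 := by
  rw [show (w.map fun b => Ideal.Quotient.mk (truncIdeal Bool k N) (L b)) =
    (w.map L).map (Ideal.Quotient.mk (truncIdeal Bool k N)) from by rw [List.map_map]; rfl,
    ← map_list_prod]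
  exact mk_list_prod_eq_zero _ (fun S hS => by
    obtain ⟨b, -, rfl⟩ := List.mem_map.mp hS; exact hL b) (by simpa using hw)

/-- **`R` in the truncated free algebra on `X, Y`**: Furusho's
`R(a, b) = ψ(a, b) + ψ(b, -a-b) + ψ(-a-b, a)`. [cite: Furusho2010, §1] -/
def Rxy (N : ℕ) (ψ : NCSeries Bool k) (a b : NCSeries Bool k ⧸ truncIdeal Bool k N) :
    NCSeries Bool k ⧸ truncIdeal Bool k N :=
  evalTrunc N (bsub a b) ψ + evalTrunc N (bsub b (-a - b)) ψ + evalTrunc N (bsub (-a - b) a) ψ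

variable [Algebra ℚ k]

/-- Halving in a module over a `ℚ`-algebra. [folklore] -/
theorem eq_zero_of_add_self_eq_zero {M : Type*} [AddCommGroup M] [Module k M] {x : M}
    (h : x + x = 0) : x = 0 := by
  have h2 := congrArg (fun z => algebraMap ℚ k (1 / 2) • z) h
  simp only [smul_add, smul_zero] at h2
  rwa [← add_smul, ← map_add, show (1 / 2 : ℚ) + 1 / 2 = 1 by norm_num, map_one, one_smul] at h2

/-- `R(a, a) = 0`: all three terms are degenerate evaluations. [folklore] -/
theorem Rxy_self (hp : IsPrimitive ψ) (h0 : ψ [false] = 0) (h1 : ψ [true] = 0)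
    (a : NCSeries Bool k ⧸ truncIdeal Bool k N) : Rxy N ψ a a = 0 := by
  unfold Rxy
  rw [hp.evalTrunc_eq_zero_of_commute h0 h1 N (Commute.refl a),
    hp.evalTrunc_eq_zero_of_commute h0 h1 N ((Commute.refl a).neg_right.sub_right (Commute.refl a)),
    hp.evalTrunc_eq_zero_of_commute h0 h1 N ((Commute.refl a).neg_left.sub_left (Commute.refl a)),
    add_zero, add_zero]

omit [Algebra ℚ k] in
/-- `R(b, a) = -R(a, b)` for anti-symmetric `ψ`. [folklore] -/
theorem Rxy_swap (hanti : ψ + swapXY ψ = 0) (a b : NCSeries Bool k ⧸ truncIdeal Bool k N) :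
    Rxy N ψ b a = -Rxy N ψ a b := by
  unfold Rxy
  rw [eval_antisymm hanti N a b, eval_antisymm hanti N (-b - a) a, eval_antisymm hanti N b (-b - a),
    show -b - a = -a - b by abel]
  abel

/-- **The two projected identities** [BarnatanDancso2011, §4, `p₁`, `p₂`; Furusho2010, §1,
`q₁`, `q₂`]: for `ψ` primitive, without terms of degree `≤ 1`, anti-symmetric, with
`dP_N(ψ) = 0`: `R(X+Y, X) = -R(X,Y)` and `R(X+X, Y) = R(X,Y) + R(X,Y)`.
[cite: BarnatanDancso2011, §4] -/
theorem Rxy_identities (hp : IsPrimitive ψ) (h0 : ψ [false] = 0) (h1 : ψ [true] = 0)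
    (hanti : ψ + swapXY ψ = 0) (hP : dP k N ψ = 0) :
    Rxy N ψ (𝒳 + 𝒴) 𝒳 = -Rxy N ψ 𝒳 𝒴 ∧ Rxy N ψ (𝒳 + 𝒳) 𝒴 = Rxy N ψ 𝒳 𝒴 + Rxy N ψ 𝒳 𝒴 := by
  have hS := sum_R_eq_zero_of_dP hp h0 h1 hanti hP
  -- transport by the retraction: rewrite every argument as an explicit combination
  have hV := congrArg (fun x : DrinfeldKohnoTrunc k (Fin 4) N =>
    (rep k N x) (1 : NCSeries (Fin 3) k ⧸ truncIdeal (Fin 3) k N)) hS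
  simp only [map_add, map_zero, LinearMap.add_apply, LinearMap.zero_apply] at hV
  have e01 : DrinfeldKohnoTrunc.t k N (0 : Fin 4) 1 =
      (1 : k) • DrinfeldKohnoTrunc.t k N 0 1 + (0 : k) • DrinfeldKohnoTrunc.t k N 1 2 +
        (0 : k) • DrinfeldKohnoTrunc.t k N 1 3 := by simp
  have e12 : DrinfeldKohnoTrunc.t k N (1 : Fin 4) 2 =
      (0 : k) • DrinfeldKohnoTrunc.t k N 0 1 + (1 : k) • DrinfeldKohnoTrunc.t k N 1 2 +
        (0 : k) • DrinfeldKohnoTrunc.t k N 1 3 := by simp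
  have e13 : DrinfeldKohnoTrunc.t k N (1 : Fin 4) 3 =
      (0 : k) • DrinfeldKohnoTrunc.t k N 0 1 + (0 : k) • DrinfeldKohnoTrunc.t k N 1 2 +
        (1 : k) • DrinfeldKohnoTrunc.t k N 1 3 := by simp
  have e1213 : DrinfeldKohnoTrunc.t k N (1 : Fin 4) 2 + DrinfeldKohnoTrunc.t k N 1 3 =
      (0 : k) • DrinfeldKohnoTrunc.t k N 0 1 + (1 : k) • DrinfeldKohnoTrunc.t k N 1 2 +
        (1 : k) • DrinfeldKohnoTrunc.t k N 1 3 := by simp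
  have e1201 : DrinfeldKohnoTrunc.t k N (1 : Fin 4) 2 + DrinfeldKohnoTrunc.t k N 0 1 =
      (1 : k) • DrinfeldKohnoTrunc.t k N 0 1 + (1 : k) • DrinfeldKohnoTrunc.t k N 1 2 +
        (0 : k) • DrinfeldKohnoTrunc.t k N 1 3 := by simp [add_comm]
  have n0112 : -DrinfeldKohnoTrunc.t k N (0 : Fin 4) 1 - DrinfeldKohnoTrunc.t k N 1 2 =
      (-1 : k) • DrinfeldKohnoTrunc.t k N 0 1 + (-1 : k) • DrinfeldKohnoTrunc.t k N 1 2 +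
        (0 : k) • DrinfeldKohnoTrunc.t k N 1 3 := by simp; abel
  have n121301 : -(DrinfeldKohnoTrunc.t k N (1 : Fin 4) 2 + DrinfeldKohnoTrunc.t k N 1 3) -
      DrinfeldKohnoTrunc.t k N 0 1 =
      (-1 : k) • DrinfeldKohnoTrunc.t k N 0 1 + (-1 : k) • DrinfeldKohnoTrunc.t k N 1 2 +
        (-1 : k) • DrinfeldKohnoTrunc.t k N 1 3 := by simp; abel
  have n1312 : -DrinfeldKohnoTrunc.t k N (1 : Fin 4) 3 - DrinfeldKohnoTrunc.t k N 1 2 =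
      (0 : k) • DrinfeldKohnoTrunc.t k N 0 1 + (-1 : k) • DrinfeldKohnoTrunc.t k N 1 2 +
        (-1 : k) • DrinfeldKohnoTrunc.t k N 1 3 := by simp; abel
  have n120113 : -(DrinfeldKohnoTrunc.t k N (1 : Fin 4) 2 + DrinfeldKohnoTrunc.t k N 0 1) -
      DrinfeldKohnoTrunc.t k N 1 3 =
      (-1 : k) • DrinfeldKohnoTrunc.t k N 0 1 + (-1 : k) • DrinfeldKohnoTrunc.t k N 1 2 +
        (-1 : k) • DrinfeldKohnoTrunc.t k N 1 3 := by simp; abel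
  have tr : ∀ (a₁ b₁ c₁ a₂ b₂ c₂ : k) (a b : DrinfeldKohnoTrunc k (Fin 4) N),
      a = a₁ • DrinfeldKohnoTrunc.t k N 0 1 + b₁ • DrinfeldKohnoTrunc.t k N 1 2 +
        c₁ • DrinfeldKohnoTrunc.t k N 1 3 →
      b = a₂ • DrinfeldKohnoTrunc.t k N 0 1 + b₂ • DrinfeldKohnoTrunc.t k N 1 2 +
        c₂ • DrinfeldKohnoTrunc.t k N 1 3 →
      rep k N (evalTrunc N (bsub a b) ψ) 1 =
        evalTrunc N (bsub (a₁ • xg N 0 + b₁ • xg N 1 + c₁ • xg N 2)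
          (a₂ • xg N 0 + b₂ • xg N 1 + c₂ • xg N 2)) ψ := by
    rintro _ _ _ _ _ _ _ _ rfl rfl
    exact rep_eval_vec_one ..
  rw [tr _ _ _ _ _ _ _ _ e01 e12, tr _ _ _ _ _ _ _ _ e12 n0112, tr _ _ _ _ _ _ _ _ n0112 e01,
    tr _ _ _ _ _ _ _ _ e1213 e01, tr _ _ _ _ _ _ _ _ e01 n121301, tr _ _ _ _ _ _ _ _ n121301 e1213,
    tr _ _ _ _ _ _ _ _ e13 e12, tr _ _ _ _ _ _ _ _ e12 n1312, tr _ _ _ _ _ _ _ _ n1312 e13,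
    tr _ _ _ _ _ _ _ _ e1201 e13, tr _ _ _ _ _ _ _ _ e13 n120113, tr _ _ _ _ _ _ _ _ n120113 e1201]
    at hV
  simp only [one_smul, zero_smul, neg_smul, add_zero, zero_add] at hV
  -- hV : the same identity in `V`; the two projections
  have hv₁ : ∀ w : List (Fin 3), N < w.length → (w.map (![𝒳, 𝒴, 𝒳] : Fin 3 → _)).prod = 0 := by
    intro w hw
    have h := prod_map_mk_eq_zero (N := N) (![X₀, X₁, X₀] : Fin 3 → NCSeries Bool k)
      (fun b => by fin_cases b <;> simp) w hw
    refine Eq.trans ?_ h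
    congr 1
    refine List.map_congr_left fun b _ => ?_
    fin_cases b <;> rfl
  have hv₂ : ∀ w : List (Fin 3), N < w.length → (w.map (![𝒳, 𝒳, 𝒴] : Fin 3 → _)).prod = 0 := by
    intro w hw
    have h := prod_map_mk_eq_zero (N := N) (![X₀, X₀, X₁] : Fin 3 → NCSeries Bool k)
      (fun b => by fin_cases b <;> simp) w hw
    refine Eq.trans ?_ h
    congr 1
    refine List.map_congr_left fun b _ => ?_
    fin_cases b <;> rfl
  have hp₁ := congrArg (evalQuotHom N (![𝒳, 𝒴, 𝒳] : Fin 3 → _) hv₁) hV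
  have hp₂ := congrArg (evalQuotHom N (![𝒳, 𝒳, 𝒴] : Fin 3 → _) hv₂) hV
  have x1 : evalQuotHom N (![𝒳, 𝒴, 𝒳] : Fin 3 → _) hv₁ (xg (k := k) N 0) = 𝒳 := by
    rw [evalQuotHom_mk]; exact evalTrunc_letter N _ hv₁ 0
  have y1 : evalQuotHom N (![𝒳, 𝒴, 𝒳] : Fin 3 → _) hv₁ (xg (k := k) N 1) = 𝒴 := by
    rw [evalQuotHom_mk]; exact evalTrunc_letter N _ hv₁ 1
  have z1 : evalQuotHom N (![𝒳, 𝒴, 𝒳] : Fin 3 → _) hv₁ (xg (k := k) N 2) = 𝒳 := by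
    rw [evalQuotHom_mk]; exact evalTrunc_letter N _ hv₁ 2
  have x2 : evalQuotHom N (![𝒳, 𝒳, 𝒴] : Fin 3 → _) hv₂ (xg (k := k) N 0) = 𝒳 := by
    rw [evalQuotHom_mk]; exact evalTrunc_letter N _ hv₂ 0
  have y2 : evalQuotHom N (![𝒳, 𝒳, 𝒴] : Fin 3 → _) hv₂ (xg (k := k) N 1) = 𝒳 := by
    rw [evalQuotHom_mk]; exact evalTrunc_letter N _ hv₂ 1
  have z2 : evalQuotHom N (![𝒳, 𝒳, 𝒴] : Fin 3 → _) hv₂ (xg (k := k) N 2) = 𝒴 := by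
    rw [evalQuotHom_mk]; exact evalTrunc_letter N _ hv₂ 2
  simp only [map_add, map_zero, algHom_evalTrunc, comp_bsub, map_neg, x1, y1, z1] at hp₁
  simp only [map_add, map_zero, algHom_evalTrunc, comp_bsub, map_neg, x2, y2, z2] at hp₂
  -- normalise the arguments to the shape of `Rxy`
  have a2 : -𝒳 + -𝒴 + -𝒳 = -(𝒳 + 𝒴) - 𝒳 := by abel
  have a1 : -𝒳 + -𝒴 = -𝒳 - 𝒴 := by abel
  have a3 : -𝒴 + -𝒳 = -𝒳 - 𝒴 := by abel
  have a4 : 𝒴 + 𝒳 = 𝒳 + 𝒴 := by abel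
  rw [a2] at hp₁
  rw [a1, a3, a4] at hp₁
  have b2 : -𝒳 + -𝒳 + -𝒴 = -(𝒳 + 𝒴) - 𝒳 := by abel
  have b1 : -𝒳 + -𝒳 = -𝒳 - 𝒳 := by abel
  have b4 : -𝒳 + -𝒴 = -𝒴 - 𝒳 := by abel
  have b3 : -(𝒳 + 𝒳) - 𝒴 = -(𝒳 + 𝒴) - 𝒳 := by abel
  rw [b2] at hp₂
  rw [b1, b4] at hp₂
  have c1 : Rxy N ψ 𝒳 𝒴 + Rxy N ψ (𝒳 + 𝒴) 𝒳 + Rxy N ψ 𝒳 𝒴 + Rxy N ψ (𝒳 + 𝒴) 𝒳 = 0 := by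
    unfold Rxy; exact hp₁
  have c2 : Rxy N ψ 𝒳 𝒳 + Rxy N ψ (𝒳 + 𝒴) 𝒳 + Rxy N ψ 𝒴 𝒳 + Rxy N ψ (𝒳 + 𝒳) 𝒴 = 0 := by
    unfold Rxy; rw [b3]; exact hp₂
  have d1 : Rxy N ψ 𝒳 𝒴 + Rxy N ψ (𝒳 + 𝒴) 𝒳 = 0 := by
    refine eq_zero_of_add_self_eq_zero (k := k) ?_
    rw [← c1]; abel
  have r1 : Rxy N ψ (𝒳 + 𝒴) 𝒳 = -Rxy N ψ 𝒳 𝒴 := eq_neg_of_add_eq_zero_right d1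
  refine ⟨r1, ?_⟩
  rw [Rxy_self hp h0 h1, Rxy_swap hanti 𝒳 𝒴, r1, zero_add] at c2
  calc Rxy N ψ (𝒳 + 𝒳) 𝒴
      = (-Rxy N ψ 𝒳 𝒴 + -Rxy N ψ 𝒳 𝒴 + Rxy N ψ (𝒳 + 𝒳) 𝒴) + (Rxy N ψ 𝒳 𝒴 + Rxy N ψ 𝒳 𝒴) := by
        abel
    _ = Rxy N ψ 𝒳 𝒴 + Rxy N ψ 𝒳 𝒴 := by rw [c2, zero_add]

/-! ## 4. The coefficient argument: `R(X,Y) = 0` -/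

omit [Algebra ℚ k] in
/-- Pulling the dilation `X ↦ X + X` out of a word: a factor `2` per letter `X`. [folklore] -/
theorem prod_map_bsub_add_self (a b : NCSeries Bool k ⧸ truncIdeal Bool k N) :
    ∀ w : List Bool, (w.map (bsub (a + a) b)).prod = (2 : k) ^ w.count false • (w.map (bsub a b)).prod
  | [] => by simp
  | false :: w => by
    rw [List.map_cons, List.prod_cons, prod_map_bsub_add_self a b w, List.map_cons, List.prod_cons,
      bsub_false, bsub_false, List.count_cons_self, pow_succ, mul_smul, mul_smul_comm, add_mul,
      two_smul]
  | true :: w => by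
    rw [List.map_cons, List.prod_cons, prod_map_bsub_add_self a b w, List.map_cons, List.prod_cons,
      bsub_true, bsub_true, List.count_cons_of_ne (by decide), mul_smul_comm]

omit [Algebra ℚ k] in
/-- Words in the letter classes are monomial classes. [folklore] -/
theorem prod_map_bsub_mk (w : List Bool) :
    (w.map (bsub 𝒳 𝒴)).prod = Ideal.Quotient.mk (truncIdeal Bool k N) (monomial w 1) := by
  have e : (bsub 𝒳 𝒴 : Bool → NCSeries Bool k ⧸ truncIdeal Bool k N) =
      fun a => Ideal.Quotient.mk (truncIdeal Bool k N) (letter ((Equiv.refl Bool) a)) := by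
    funext c; cases c <;> rfl
  rw [e, show (w.map fun a => Ideal.Quotient.mk (truncIdeal Bool k N) (letter ((Equiv.refl Bool) a))) =
    (w.map fun a => (letter ((Equiv.refl Bool) a) : NCSeries Bool k)).map
      (Ideal.Quotient.mk (truncIdeal Bool k N)) from by rw [List.map_map]; rfl,
    ← map_list_prod, prod_map_letter]
  simp

omit [Algebra ℚ k] in
/-- Exchanging letters exchanges the count of `X`'s for the count of `Y`'s. [folklore] -/
theorem count_false_map_not : ∀ w : List Bool, (w.map not).count false = w.count true
  | [] => rfl
  | false :: w => by
    rw [List.map_cons, Bool.not_false, List.count_cons_of_ne (by decide),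
      List.count_cons_of_ne (by decide), count_false_map_not w]
  | true :: w => by
    rw [List.map_cons, Bool.not_true, List.count_cons_self, List.count_cons_self,
      count_false_map_not w]

omit [Algebra ℚ k] in
/-- Evaluations of a series without terms of weight `≤ d` at arguments without constant term
have no terms of weight `≤ d`. [folklore] -/
theorem evalTrunc_apply_eq_zero_of_low {A B : NCSeries Bool k} (hA : A [] = 0) (hB : B [] = 0)
    {d : ℕ} (hψ : ∀ w : List Bool, w.length ≤ d → ψ w = 0) {u : List Bool} (hu : u.length ≤ d) :
    (evalTrunc N (bsub A B) ψ) u = 0 := by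
  rw [evalTrunc_eq_sum_wordsLE, finset_sum_apply]
  refine Finset.sum_eq_zero fun w _ => ?_
  rw [smul_apply, smul_eq_mul]
  by_cases hw : w.length ≤ d
  · rw [hψ w hw, zero_mul]
  · rw [list_prod_apply_eq_zero _ (fun S hS => ?_) u (by simp; omega), mul_zero]
    obtain ⟨c, -, rfl⟩ := List.mem_map.mp hS
    cases c
    · exact hA
    · exact hB

omit [Algebra ℚ k] in
/-- `2ⁿ - 2 ≠ 0` in `ℚ` for `n ≠ 1`. [folklore] -/
theorem two_pow_sub_two_ne_zero {n : ℕ} (hn : n ≠ 1) : (2 : ℚ) ^ n - 2 ≠ 0 := by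
  rcases Nat.lt_or_gt_of_ne hn with h | h
  · have : n = 0 := by omega
    subst this; norm_num
  · have h4 : (2 : ℚ) ^ 2 ≤ 2 ^ n := pow_le_pow_right₀ (by norm_num) h
    intro h0
    have : (2 : ℚ) ^ n = 2 := by linarith
    rw [this] at h4
    norm_num at h4

/-- **`R(X,Y) = 0`** [BarnatanDancso2011, §4, end of the proof of the Main Lemma; Furusho2010,
§1, end of the proof of Thm 3]: `R(2X,Y) = 2R(X,Y)` forces `R` to be supported on words with
exactly one `X`; anti-symmetry `R(Y,X) = -R(X,Y)` exchanges these with words with exactly one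
`Y`, and `R` has no terms of degree `≤ 2` when `ψ` has none; hence `R(X,Y) = 0`.
[cite: BarnatanDancso2011, §4] -/
theorem Rxy_eq_zero (hp : IsPrimitive ψ) (hlow : ∀ w : List Bool, w.length ≤ 2 → ψ w = 0)
    (hanti : ψ + swapXY ψ = 0) (hP : dP k N ψ = 0) : Rxy N ψ 𝒳 𝒴 = 0 := by
  have h0 : ψ [false] = 0 := hlow _ (by simp)
  have h1 : ψ [true] = 0 := hlow _ (by simp)
  obtain ⟨-, c2⟩ := Rxy_identities hp h0 h1 hanti hP
  -- the series form of `R(X,Y)`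
  set ρ : NCSeries Bool k := evalTrunc N (bsub X₀ X₁) ψ + evalTrunc N (bsub X₁ (-X₀ - X₁)) ψ +
    evalTrunc N (bsub (-X₀ - X₁) X₀) ψ with hρdef
  have hρ : Ideal.Quotient.mk (truncIdeal Bool k N) ρ = Rxy N ψ 𝒳 𝒴 := by
    simp only [hρdef, Rxy, map_add, map_sub, map_neg, mk_evalTrunc]
  have hX₀ : (X₀ : NCSeries Bool k) [] = 0 := by simp
  have hX₁ : (X₁ : NCSeries Bool k) [] = 0 := by simp
  have hZ : (-X₀ - X₁ : NCSeries Bool k) [] = 0 := by simp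
  -- (i) dilation `X ↦ X + X`
  have hvδ : ∀ w : List Bool, N < w.length → (w.map (bsub (𝒳 + 𝒳) 𝒴)).prod = 0 := by
    intro w hw
    have h := prod_map_mk_eq_zero (N := N) (bsub (X₀ + X₀) X₁ : Bool → NCSeries Bool k)
      (fun b => by cases b <;> simp) w hw
    refine Eq.trans ?_ h
    congr 1
    refine List.map_congr_left fun b _ => ?_
    cases b <;> simp [map_add]
  have hδR : evalQuotHom N (bsub (𝒳 + 𝒳) 𝒴) hvδ (Rxy N ψ 𝒳 𝒴) = Rxy N ψ (𝒳 + 𝒳) 𝒴 := by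
    have hx : evalQuotHom N (bsub (𝒳 + 𝒳) 𝒴) hvδ 𝒳 = 𝒳 + 𝒳 := by
      rw [evalQuotHom_mk]; exact evalTrunc_letter N _ hvδ false
    have hy : evalQuotHom N (bsub (𝒳 + 𝒳) 𝒴) hvδ 𝒴 = 𝒴 := by
      rw [evalQuotHom_mk]; exact evalTrunc_letter N _ hvδ true
    simp only [Rxy, map_add, map_sub, map_neg, algHom_evalTrunc, comp_bsub, hx, hy]
  have hδρ : evalQuotHom N (bsub (𝒳 + 𝒳) 𝒴) hvδ (Ideal.Quotient.mk (truncIdeal Bool k N) ρ) =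
      Ideal.Quotient.mk (truncIdeal Bool k N) (fun w => (2 : k) ^ w.count false * ρ w) := by
    rw [evalQuotHom_mk, evalTrunc_eq_sum_wordsLE, mk_eq_sum_monomial N (fun w => (2 : k) ^ w.count false * ρ w)]
    refine Finset.sum_congr rfl fun w _ => ?_
    rw [prod_map_bsub_add_self, prod_map_bsub_mk, smul_smul, mul_comm]
  have hdil : ∀ w : List Bool, w.length ≤ N → w.count false ≠ 1 → ρ w = 0 := by
    intro w hw hc
    have h := hδρ
    rw [hρ, hδR, c2, ← hρ, ← map_add, mk_eq_mk_iff] at h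
    have hw' := h w hw
    simp only [add_apply] at hw'
    -- (2^c - 2) ρ_w = 0
    have h3 : algebraMap ℚ k ((2 : ℚ) ^ w.count false - 2) * ρ w = 0 := by
      rw [map_sub, map_pow, map_ofNat, sub_mul, ← hw', two_mul, sub_self]
    have hq := two_pow_sub_two_ne_zero hc
    calc ρ w = algebraMap ℚ k (((2 : ℚ) ^ w.count false - 2)⁻¹) *
          (algebraMap ℚ k ((2 : ℚ) ^ w.count false - 2) * ρ w) := by
            rw [← mul_assoc, ← map_mul, inv_mul_cancel₀ hq, map_one, one_mul]
      _ = 0 := by rw [h3, mul_zero]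
  -- (ii) anti-symmetry `R(Y,X) = -R(X,Y)`
  have hvς : ∀ w : List Bool, N < w.length → (w.map (bsub 𝒴 𝒳)).prod = 0 := by
    intro w hw
    have h := prod_map_mk_eq_zero (N := N) (bsub X₁ X₀ : Bool → NCSeries Bool k)
      (fun b => by cases b <;> simp) w hw
    refine Eq.trans ?_ h
    congr 1
    refine List.map_congr_left fun b _ => ?_
    cases b <;> rfl
  have hςR : evalQuotHom N (bsub 𝒴 𝒳) hvς (Rxy N ψ 𝒳 𝒴) = Rxy N ψ 𝒴 𝒳 := by
    have hx : evalQuotHom N (bsub 𝒴 𝒳) hvς 𝒳 = 𝒴 := by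
      rw [evalQuotHom_mk]; exact evalTrunc_letter N _ hvς false
    have hy : evalQuotHom N (bsub 𝒴 𝒳) hvς 𝒴 = 𝒳 := by
      rw [evalQuotHom_mk]; exact evalTrunc_letter N _ hvς true
    simp only [Rxy, map_add, map_sub, map_neg, algHom_evalTrunc, comp_bsub, hx, hy]
  have hςρ : evalQuotHom N (bsub 𝒴 𝒳) hvς (Ideal.Quotient.mk (truncIdeal Bool k N) ρ) =
      Ideal.Quotient.mk (truncIdeal Bool k N) (swapXY ρ) := by
    rw [evalQuotHom_mk, ← mk_evalTrunc, mk_evalTrunc_X₁_X₀]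
  have hswap : ∀ w : List Bool, w.length ≤ N → ρ (w.map not) = -ρ w := by
    intro w hw
    have h := hςρ
    rw [hρ, hςR, Rxy_swap hanti 𝒳 𝒴, ← hρ, ← map_neg, mk_eq_mk_iff] at h
    have := h w hw
    rw [neg_apply, swapXY_apply] at this
    exact this.symm
  -- (iii) no terms of degree ≤ 2
  have hlowρ : ∀ w : List Bool, w.length ≤ 2 → ρ w = 0 := by
    intro w hw
    simp only [hρdef, add_apply]
    rw [evalTrunc_apply_eq_zero_of_low hX₀ hX₁ hlow hw, evalTrunc_apply_eq_zero_of_low hX₁ hZ hlow hw,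
      evalTrunc_apply_eq_zero_of_low hZ hX₀ hlow hw, add_zero, add_zero]
  -- conclusion
  rw [← hρ, Ideal.Quotient.eq_zero_iff_mem, mem_truncIdeal]
  intro w hw
  by_cases hc : w.count false = 1
  · by_cases hl : w.length ≤ 2
    · exact hlowρ w hl
    · have hlen : w.count false + w.count true = w.length := List.count_not_add_count w true
      have hc' : (w.map not).count false ≠ 1 := by rw [count_false_map_not]; omega
      have h1' := hdil (w.map not) (by simpa using hw) hc'
      rw [hswap w hw, neg_eq_zero] at h1'
      exact h1'
  · exact hdil w hw hc

/-! ## 5. The Main Lemma -/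

/-- **[Furusho2010, Thm 3] = [BarnatanDancso2011, Main Lemma 3.2]: the linearized pentagon
implies the linearized hexagon.** Let `ψ ∈ k⟨⟨X,Y⟩⟩` (`k` a commutative `ℚ`-algebra) be
primitive (Lie-like), without terms of degree `≤ 2`, supported in degree `≤ N`, and suppose
`dP_N(ψ) = 0` in `U𝔞₄ ⊗ k/(deg > N)`. Then `dH_N(ψ) = 0`. (For `ψ` homogeneous of degree
`m ≥ 3` take `N = m`; Furusho's form is the same statement in the quotient `𝔓₅` of `𝔞₄`; the
hypothesis "no terms of degree `≤ 2`" is his `c₂ = 0` plus commutator-Lie-likeness, and is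
necessary: `ψ = [X,Y]` satisfies `dP = 0` but not `dH = 0`.) Proof as printed (BN–D §4):
anti-symmetry (Lemma 4.1), `Σᵢ σᵢ(dP) = Σ dH = Σ R` on chords through one strand, freeness of
that subalgebra (retraction), the projections `p₁, p₂`, the coefficient argument, and Lemma 4.2
(`dH(ψ) = ι(R(X,Y))` by central shifts). [cite: Furusho2010, Thm 3] -/
theorem main_lemma (hp : IsPrimitive ψ) (hlow : ∀ w : List Bool, w.length ≤ 2 → ψ w = 0)
    (hsupp : ∀ w : List Bool, N < w.length → ψ w = 0) (hP : dP k N ψ = 0) : dH k N ψ = 0 := by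
  have h0 : ψ [false] = 0 := hlow _ (by simp)
  have h1 : ψ [true] = 0 := hlow _ (by simp)
  have hanti : ψ + swapXY ψ = 0 := hp.antisymm_of_dP h0 h1 hsupp hP
  have hR := Rxy_eq_zero hp hlow hanti hP
  -- evaluate `R(X,Y) = 0` at `X ↦ t₀₁, Y ↦ t₁₂`
  have hmem1 : DrinfeldKohnoTrunc.t k N (0 : Fin 4) 1 ∈
      (DrinfeldKohnoTrunc.genSpan : Submodule k (DrinfeldKohnoTrunc k (Fin 4) N)) :=
    DrinfeldKohnoTrunc.t_mem_genSpan 0 1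
  have hmem2 : DrinfeldKohnoTrunc.t k N (1 : Fin 4) 2 ∈
      (DrinfeldKohnoTrunc.genSpan : Submodule k (DrinfeldKohnoTrunc k (Fin 4) N)) :=
    DrinfeldKohnoTrunc.t_mem_genSpan 1 2
  have hvι : ∀ w : List Bool, N < w.length →
      (w.map (bsub (DrinfeldKohnoTrunc.t k N (0 : Fin 4) 1) (DrinfeldKohnoTrunc.t k N 1 2))).prod = 0 :=
    DrinfeldKohnoTrunc.prod_map_eq_zero_of_mem_genSpan _ (fun c => by cases c <;> assumption)
  have hι := congrArg (evalQuotHom N _ hvι) hR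
  have hx : evalQuotHom N _ hvι 𝒳 = DrinfeldKohnoTrunc.t k N (0 : Fin 4) 1 := by
    rw [evalQuotHom_mk]; exact evalTrunc_letter N _ hvι false
  have hy : evalQuotHom N _ hvι 𝒴 = DrinfeldKohnoTrunc.t k N (1 : Fin 4) 2 := by
    rw [evalQuotHom_mk]; exact evalTrunc_letter N _ hvι true
  simp only [Rxy, map_add, map_sub, map_neg, map_zero, algHom_evalTrunc, comp_bsub, hx, hy] at hι
  -- `dH = ψ(t₀₂,t₀₁) - ψ(t₀₂,t₁₂) + ψ(t₀₁,t₁₂)`; central shifts with `c = t₀₁ + t₀₂ + t₁₂`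
  have cA1 : Commute (DrinfeldKohnoTrunc.t k N (0 : Fin 4) 1 + DrinfeldKohnoTrunc.t k N 0 2 +
      DrinfeldKohnoTrunc.t k N 1 2) (DrinfeldKohnoTrunc.t k N 0 1) := by
    rw [add_assoc]
    exact ((Commute.refl _).add_left DrinfeldKohnoTrunc.commute_t01_t02_add_t12.symm)
  have cA2 : Commute (DrinfeldKohnoTrunc.t k N (0 : Fin 4) 1 + DrinfeldKohnoTrunc.t k N 0 2 +
      DrinfeldKohnoTrunc.t k N 1 2) (DrinfeldKohnoTrunc.t k N 1 2) :=
    (DrinfeldKohnoTrunc.commute_t12_t01_add_t02.symm).add_left (Commute.refl _)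
  have cAz : Commute (DrinfeldKohnoTrunc.t k N (0 : Fin 4) 1 + DrinfeldKohnoTrunc.t k N 0 2 +
      DrinfeldKohnoTrunc.t k N 1 2)
      (-DrinfeldKohnoTrunc.t k N 0 1 - DrinfeldKohnoTrunc.t k N 1 2) := (cA1.neg_right).sub_right cA2
  have eA : DrinfeldKohnoTrunc.t k N (0 : Fin 4) 2 =
      (-DrinfeldKohnoTrunc.t k N 0 1 - DrinfeldKohnoTrunc.t k N 1 2) +
        (DrinfeldKohnoTrunc.t k N 0 1 + DrinfeldKohnoTrunc.t k N 0 2 + DrinfeldKohnoTrunc.t k N 1 2) := by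
    abel
  have s1 : evalTrunc N (bsub (DrinfeldKohnoTrunc.t k N (0 : Fin 4) 2) (DrinfeldKohnoTrunc.t k N 0 1)) ψ =
      evalTrunc N (bsub (-DrinfeldKohnoTrunc.t k N 0 1 - DrinfeldKohnoTrunc.t k N 1 2)
        (DrinfeldKohnoTrunc.t k N 0 1)) ψ := by
    rw [eA]; exact hp.evalTrunc_bsub_add_left h0 N cAz cA1
  have s2 : evalTrunc N (bsub (DrinfeldKohnoTrunc.t k N (0 : Fin 4) 2) (DrinfeldKohnoTrunc.t k N 1 2)) ψ =
      -evalTrunc N (bsub (DrinfeldKohnoTrunc.t k N 1 2)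
        (-DrinfeldKohnoTrunc.t k N 0 1 - DrinfeldKohnoTrunc.t k N 1 2)) ψ := by
    rw [eA, hp.evalTrunc_bsub_add_left h0 N cAz cA2,
      eval_antisymm hanti N (DrinfeldKohnoTrunc.t k N (1 : Fin 4) 2)]
  show evalTrunc N (bsub (DrinfeldKohnoTrunc.t k N (0 : Fin 4) 2) (DrinfeldKohnoTrunc.t k N 0 1)) ψ -
      evalTrunc N (bsub (DrinfeldKohnoTrunc.t k N (0 : Fin 4) 2) (DrinfeldKohnoTrunc.t k N 1 2)) ψ +
      evalTrunc N (bsub (DrinfeldKohnoTrunc.t k N (0 : Fin 4) 1) (DrinfeldKohnoTrunc.t k N 1 2)) ψ = 0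
  rw [s1, s2, ← hι]
  abel

end Projections

end NCSeries

end Literature.NumberTheory.Transcendental
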